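import Summits.CriticalPhenomena.PercolationContinuityZ3.Theorems.PercNearOneGluingNoHeavyLowerTailThreePointProductFormHubWordsMonotone
import Mathlib.Tactic.Linarith
import Mathlib.Tactic.NormNum
import Mathlib.Tactic.IntervalCases
import HarnessLib

/-!
# Hub words over ℕ, VI: THEOREM M — `D` is nondecreasing in every letter (all hub words)
# (Sahi programme, prover prim-sahi-p2 gen 64; memo `FROM-prim-sahi-p2-gen64-ABPLUS-PROOF.md` §12)

Support file (`--supports stmt-CriticalPhenomena-4575`).  Standard axioms, no sorries, no named facts, no new definitions.
Part V gives the increment `D(Y (c+1) Z) − D(Y c Z) ≥ 0` for `Σ ≥ 5` and shows it does not decrease under insertion of bare vertices; here the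
80 zero-free increments with `Σ ≤ 4` are evaluated exactly (`incr_fin_*`, grouped by `(Y, c)`), the zeros are stripped by induction (`D_mono_small`),
and THEOREM M follows: `D (Y ++ c :: Z) ≤ D (Y ++ (c+1) :: Z)` for all `Y, Z, c` (`D_mono`), hence `D w ≤ D w′` whenever `w ≤ w′` letterwise
(`hubWords_D_monotone`).  With THEOREM B (`hubWords_D_nonneg`) and `D [] = D [1] = D [2] = D [1,1] = 0` (part II). [this work]
-/

namespace Summit.CriticalPhenomena.PercolationContinuityZ3.Theorems.ProductFormHubWords

/-- finite increments, `Y = []`, `c = 0`: all zero-free `Z` with `Σ Z ≤ 4` (16 exact evaluations). [this work] -/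
theorem incr_fin_0_0 : ∀ Z ∈ GF 4, 0 ≤ D ([] ++ (0+1) :: Z) - D ([] ++ 0 :: Z) := by
  intro Z hZ
  simp only [GF, List.mem_cons, List.mem_nil_iff, or_false] at hZ
  rcases hZ with rfl|rfl|rfl|rfl|rfl|rfl|rfl|rfl|rfl|rfl|rfl|rfl|rfl|rfl|rfl|rfl
  all_goals (simp only [D, D6, alphaF, evalW, step, omega, List.nil_append, List.sum_cons, List.sum_nil]; norm_num)

/-- finite increments, `Y = []`, `c = 1`: all zero-free `Z` with `Σ Z ≤ 3` (8 exact evaluations). [this work] -/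
theorem incr_fin_0_1 : ∀ Z ∈ GF 3, 0 ≤ D ([] ++ (1+1) :: Z) - D ([] ++ 1 :: Z) := by
  intro Z hZ
  simp only [GF, List.mem_cons, List.mem_nil_iff, or_false] at hZ
  rcases hZ with rfl|rfl|rfl|rfl|rfl|rfl|rfl|rfl
  all_goals (simp only [D, D6, alphaF, evalW, step, omega, List.nil_append, List.sum_cons, List.sum_nil]; norm_num)

/-- finite increments, `Y = []`, `c = 2`: all zero-free `Z` with `Σ Z ≤ 2` (4 exact evaluations). [this work] -/
theorem incr_fin_0_2 : ∀ Z ∈ GF 2, 0 ≤ D ([] ++ (2+1) :: Z) - D ([] ++ 2 :: Z) := by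
  intro Z hZ
  simp only [GF, List.mem_cons, List.mem_nil_iff, or_false] at hZ
  rcases hZ with rfl|rfl|rfl|rfl
  all_goals (simp only [D, D6, alphaF, evalW, step, omega, List.nil_append, List.sum_cons, List.sum_nil]; norm_num)

/-- finite increments, `Y = []`, `c = 3`: all zero-free `Z` with `Σ Z ≤ 1` (2 exact evaluations). [this work] -/
theorem incr_fin_0_3 : ∀ Z ∈ GF 1, 0 ≤ D ([] ++ (3+1) :: Z) - D ([] ++ 3 :: Z) := by
  intro Z hZ
  simp only [GF, List.mem_cons, List.mem_nil_iff, or_false] at hZ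
  rcases hZ with rfl|rfl
  all_goals (simp only [D, D6, alphaF, evalW, step, omega, List.nil_append, List.sum_cons, List.sum_nil]; norm_num)

/-- finite increments, `Y = []`, `c = 4`: all zero-free `Z` with `Σ Z ≤ 0` (1 exact evaluation). [this work] -/
theorem incr_fin_0_4 : ∀ Z ∈ GF 0, 0 ≤ D ([] ++ (4+1) :: Z) - D ([] ++ 4 :: Z) := by
  intro Z hZ
  simp only [GF, List.mem_cons, List.mem_nil_iff, or_false] at hZ
  subst hZ
  simp only [D, D6, alphaF, evalW, step, omega, List.nil_append, List.sum_cons, List.sum_nil]; norm_num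

/-- finite increments, `Y = [1]`, `c = 0`: all zero-free `Z` with `Σ Z ≤ 3` (8 exact evaluations). [this work] -/
theorem incr_fin_1_0 : ∀ Z ∈ GF 3, 0 ≤ D ([1] ++ (0+1) :: Z) - D ([1] ++ 0 :: Z) := by
  intro Z hZ
  simp only [GF, List.mem_cons, List.mem_nil_iff, or_false] at hZ
  rcases hZ with rfl|rfl|rfl|rfl|rfl|rfl|rfl|rfl
  all_goals (simp only [D, D6, alphaF, evalW, step, omega, List.cons_append, List.nil_append, List.sum_cons, List.sum_nil]; norm_num)

/-- finite increments, `Y = [1]`, `c = 1`: all zero-free `Z` with `Σ Z ≤ 2` (4 exact evaluations). [this work] -/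
theorem incr_fin_1_1 : ∀ Z ∈ GF 2, 0 ≤ D ([1] ++ (1+1) :: Z) - D ([1] ++ 1 :: Z) := by
  intro Z hZ
  simp only [GF, List.mem_cons, List.mem_nil_iff, or_false] at hZ
  rcases hZ with rfl|rfl|rfl|rfl
  all_goals (simp only [D, D6, alphaF, evalW, step, omega, List.cons_append, List.nil_append, List.sum_cons, List.sum_nil]; norm_num)

/-- finite increments, `Y = [1]`, `c = 2`: all zero-free `Z` with `Σ Z ≤ 1` (2 exact evaluations). [this work] -/
theorem incr_fin_1_2 : ∀ Z ∈ GF 1, 0 ≤ D ([1] ++ (2+1) :: Z) - D ([1] ++ 2 :: Z) := by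
  intro Z hZ
  simp only [GF, List.mem_cons, List.mem_nil_iff, or_false] at hZ
  rcases hZ with rfl|rfl
  all_goals (simp only [D, D6, alphaF, evalW, step, omega, List.cons_append, List.nil_append, List.sum_cons, List.sum_nil]; norm_num)

/-- finite increments, `Y = [1]`, `c = 3`: all zero-free `Z` with `Σ Z ≤ 0` (1 exact evaluation). [this work] -/
theorem incr_fin_1_3 : ∀ Z ∈ GF 0, 0 ≤ D ([1] ++ (3+1) :: Z) - D ([1] ++ 3 :: Z) := by
  intro Z hZ
  simp only [GF, List.mem_cons, List.mem_nil_iff, or_false] at hZ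
  subst hZ
  simp only [D, D6, alphaF, evalW, step, omega, List.cons_append, List.nil_append, List.sum_cons, List.sum_nil]; norm_num

/-- finite increments, `Y = [1, 1]`, `c = 0`: all zero-free `Z` with `Σ Z ≤ 2` (4 exact evaluations). [this work] -/
theorem incr_fin_2_0 : ∀ Z ∈ GF 2, 0 ≤ D ([1, 1] ++ (0+1) :: Z) - D ([1, 1] ++ 0 :: Z) := by
  intro Z hZ
  simp only [GF, List.mem_cons, List.mem_nil_iff, or_false] at hZ
  rcases hZ with rfl|rfl|rfl|rfl
  all_goals (simp only [D, D6, alphaF, evalW, step, omega, List.cons_append, List.nil_append, List.sum_cons, List.sum_nil]; norm_num)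

/-- finite increments, `Y = [1, 1]`, `c = 1`: all zero-free `Z` with `Σ Z ≤ 1` (2 exact evaluations). [this work] -/
theorem incr_fin_2_1 : ∀ Z ∈ GF 1, 0 ≤ D ([1, 1] ++ (1+1) :: Z) - D ([1, 1] ++ 1 :: Z) := by
  intro Z hZ
  simp only [GF, List.mem_cons, List.mem_nil_iff, or_false] at hZ
  rcases hZ with rfl|rfl
  all_goals (simp only [D, D6, alphaF, evalW, step, omega, List.cons_append, List.nil_append, List.sum_cons, List.sum_nil]; norm_num)

/-- finite increments, `Y = [1, 1]`, `c = 2`: all zero-free `Z` with `Σ Z ≤ 0` (1 exact evaluation). [this work] -/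
theorem incr_fin_2_2 : ∀ Z ∈ GF 0, 0 ≤ D ([1, 1] ++ (2+1) :: Z) - D ([1, 1] ++ 2 :: Z) := by
  intro Z hZ
  simp only [GF, List.mem_cons, List.mem_nil_iff, or_false] at hZ
  subst hZ
  simp only [D, D6, alphaF, evalW, step, omega, List.cons_append, List.nil_append, List.sum_cons, List.sum_nil]; norm_num

/-- finite increments, `Y = [2]`, `c = 0`: all zero-free `Z` with `Σ Z ≤ 2` (4 exact evaluations). [this work] -/
theorem incr_fin_3_0 : ∀ Z ∈ GF 2, 0 ≤ D ([2] ++ (0+1) :: Z) - D ([2] ++ 0 :: Z) := by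
  intro Z hZ
  simp only [GF, List.mem_cons, List.mem_nil_iff, or_false] at hZ
  rcases hZ with rfl|rfl|rfl|rfl
  all_goals (simp only [D, D6, alphaF, evalW, step, omega, List.cons_append, List.nil_append, List.sum_cons, List.sum_nil]; norm_num)

/-- finite increments, `Y = [2]`, `c = 1`: all zero-free `Z` with `Σ Z ≤ 1` (2 exact evaluations). [this work] -/
theorem incr_fin_3_1 : ∀ Z ∈ GF 1, 0 ≤ D ([2] ++ (1+1) :: Z) - D ([2] ++ 1 :: Z) := by
  intro Z hZ
  simp only [GF, List.mem_cons, List.mem_nil_iff, or_false] at hZ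
  rcases hZ with rfl|rfl
  all_goals (simp only [D, D6, alphaF, evalW, step, omega, List.cons_append, List.nil_append, List.sum_cons, List.sum_nil]; norm_num)

/-- finite increments, `Y = [2]`, `c = 2`: all zero-free `Z` with `Σ Z ≤ 0` (1 exact evaluation). [this work] -/
theorem incr_fin_3_2 : ∀ Z ∈ GF 0, 0 ≤ D ([2] ++ (2+1) :: Z) - D ([2] ++ 2 :: Z) := by
  intro Z hZ
  simp only [GF, List.mem_cons, List.mem_nil_iff, or_false] at hZ
  subst hZ
  simp only [D, D6, alphaF, evalW, step, omega, List.cons_append, List.nil_append, List.sum_cons, List.sum_nil]; norm_num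

/-- finite increments, `Y = [1, 1, 1]`, `c = 0`: all zero-free `Z` with `Σ Z ≤ 1` (2 exact evaluations). [this work] -/
theorem incr_fin_4_0 : ∀ Z ∈ GF 1, 0 ≤ D ([1, 1, 1] ++ (0+1) :: Z) - D ([1, 1, 1] ++ 0 :: Z) := by
  intro Z hZ
  simp only [GF, List.mem_cons, List.mem_nil_iff, or_false] at hZ
  rcases hZ with rfl|rfl
  all_goals (simp only [D, D6, alphaF, evalW, step, omega, List.cons_append, List.nil_append, List.sum_cons, List.sum_nil]; norm_num)

/-- finite increments, `Y = [1, 1, 1]`, `c = 1`: all zero-free `Z` with `Σ Z ≤ 0` (1 exact evaluation). [this work] -/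
theorem incr_fin_4_1 : ∀ Z ∈ GF 0, 0 ≤ D ([1, 1, 1] ++ (1+1) :: Z) - D ([1, 1, 1] ++ 1 :: Z) := by
  intro Z hZ
  simp only [GF, List.mem_cons, List.mem_nil_iff, or_false] at hZ
  subst hZ
  simp only [D, D6, alphaF, evalW, step, omega, List.cons_append, List.nil_append, List.sum_cons, List.sum_nil]; norm_num

/-- finite increments, `Y = [1, 2]`, `c = 0`: all zero-free `Z` with `Σ Z ≤ 1` (2 exact evaluations). [this work] -/
theorem incr_fin_5_0 : ∀ Z ∈ GF 1, 0 ≤ D ([1, 2] ++ (0+1) :: Z) - D ([1, 2] ++ 0 :: Z) := by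
  intro Z hZ
  simp only [GF, List.mem_cons, List.mem_nil_iff, or_false] at hZ
  rcases hZ with rfl|rfl
  all_goals (simp only [D, D6, alphaF, evalW, step, omega, List.cons_append, List.nil_append, List.sum_cons, List.sum_nil]; norm_num)

/-- finite increments, `Y = [1, 2]`, `c = 1`: all zero-free `Z` with `Σ Z ≤ 0` (1 exact evaluation). [this work] -/
theorem incr_fin_5_1 : ∀ Z ∈ GF 0, 0 ≤ D ([1, 2] ++ (1+1) :: Z) - D ([1, 2] ++ 1 :: Z) := by
  intro Z hZ
  simp only [GF, List.mem_cons, List.mem_nil_iff, or_false] at hZ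
  subst hZ
  simp only [D, D6, alphaF, evalW, step, omega, List.cons_append, List.nil_append, List.sum_cons, List.sum_nil]; norm_num

/-- finite increments, `Y = [2, 1]`, `c = 0`: all zero-free `Z` with `Σ Z ≤ 1` (2 exact evaluations). [this work] -/
theorem incr_fin_6_0 : ∀ Z ∈ GF 1, 0 ≤ D ([2, 1] ++ (0+1) :: Z) - D ([2, 1] ++ 0 :: Z) := by
  intro Z hZ
  simp only [GF, List.mem_cons, List.mem_nil_iff, or_false] at hZ
  rcases hZ with rfl|rfl
  all_goals (simp only [D, D6, alphaF, evalW, step, omega, List.cons_append, List.nil_append, List.sum_cons, List.sum_nil]; norm_num)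

/-- finite increments, `Y = [2, 1]`, `c = 1`: all zero-free `Z` with `Σ Z ≤ 0` (1 exact evaluation). [this work] -/
theorem incr_fin_6_1 : ∀ Z ∈ GF 0, 0 ≤ D ([2, 1] ++ (1+1) :: Z) - D ([2, 1] ++ 1 :: Z) := by
  intro Z hZ
  simp only [GF, List.mem_cons, List.mem_nil_iff, or_false] at hZ
  subst hZ
  simp only [D, D6, alphaF, evalW, step, omega, List.cons_append, List.nil_append, List.sum_cons, List.sum_nil]; norm_num

/-- finite increments, `Y = [3]`, `c = 0`: all zero-free `Z` with `Σ Z ≤ 1` (2 exact evaluations). [this work] -/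
theorem incr_fin_7_0 : ∀ Z ∈ GF 1, 0 ≤ D ([3] ++ (0+1) :: Z) - D ([3] ++ 0 :: Z) := by
  intro Z hZ
  simp only [GF, List.mem_cons, List.mem_nil_iff, or_false] at hZ
  rcases hZ with rfl|rfl
  all_goals (simp only [D, D6, alphaF, evalW, step, omega, List.cons_append, List.nil_append, List.sum_cons, List.sum_nil]; norm_num)

/-- finite increments, `Y = [3]`, `c = 1`: all zero-free `Z` with `Σ Z ≤ 0` (1 exact evaluation). [this work] -/
theorem incr_fin_7_1 : ∀ Z ∈ GF 0, 0 ≤ D ([3] ++ (1+1) :: Z) - D ([3] ++ 1 :: Z) := by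
  intro Z hZ
  simp only [GF, List.mem_cons, List.mem_nil_iff, or_false] at hZ
  subst hZ
  simp only [D, D6, alphaF, evalW, step, omega, List.cons_append, List.nil_append, List.sum_cons, List.sum_nil]; norm_num

/-- finite increments, `Y = [1, 1, 1, 1]`, `c = 0`: all zero-free `Z` with `Σ Z ≤ 0` (1 exact evaluation). [this work] -/
theorem incr_fin_8_0 : ∀ Z ∈ GF 0, 0 ≤ D ([1, 1, 1, 1] ++ (0+1) :: Z) - D ([1, 1, 1, 1] ++ 0 :: Z) := by
  intro Z hZ
  simp only [GF, List.mem_cons, List.mem_nil_iff, or_false] at hZ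
  subst hZ
  simp only [D, D6, alphaF, evalW, step, omega, List.cons_append, List.nil_append, List.sum_cons, List.sum_nil]; norm_num

/-- finite increments, `Y = [1, 1, 2]`, `c = 0`: all zero-free `Z` with `Σ Z ≤ 0` (1 exact evaluation). [this work] -/
theorem incr_fin_9_0 : ∀ Z ∈ GF 0, 0 ≤ D ([1, 1, 2] ++ (0+1) :: Z) - D ([1, 1, 2] ++ 0 :: Z) := by
  intro Z hZ
  simp only [GF, List.mem_cons, List.mem_nil_iff, or_false] at hZ
  subst hZ
  simp only [D, D6, alphaF, evalW, step, omega, List.cons_append, List.nil_append, List.sum_cons, List.sum_nil]; norm_num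

/-- finite increments, `Y = [1, 2, 1]`, `c = 0`: all zero-free `Z` with `Σ Z ≤ 0` (1 exact evaluation). [this work] -/
theorem incr_fin_10_0 : ∀ Z ∈ GF 0, 0 ≤ D ([1, 2, 1] ++ (0+1) :: Z) - D ([1, 2, 1] ++ 0 :: Z) := by
  intro Z hZ
  simp only [GF, List.mem_cons, List.mem_nil_iff, or_false] at hZ
  subst hZ
  simp only [D, D6, alphaF, evalW, step, omega, List.cons_append, List.nil_append, List.sum_cons, List.sum_nil]; norm_num

/-- finite increments, `Y = [1, 3]`, `c = 0`: all zero-free `Z` with `Σ Z ≤ 0` (1 exact evaluation). [this work] -/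
theorem incr_fin_11_0 : ∀ Z ∈ GF 0, 0 ≤ D ([1, 3] ++ (0+1) :: Z) - D ([1, 3] ++ 0 :: Z) := by
  intro Z hZ
  simp only [GF, List.mem_cons, List.mem_nil_iff, or_false] at hZ
  subst hZ
  simp only [D, D6, alphaF, evalW, step, omega, List.cons_append, List.nil_append, List.sum_cons, List.sum_nil]; norm_num

/-- finite increments, `Y = [2, 1, 1]`, `c = 0`: all zero-free `Z` with `Σ Z ≤ 0` (1 exact evaluation). [this work] -/
theorem incr_fin_12_0 : ∀ Z ∈ GF 0, 0 ≤ D ([2, 1, 1] ++ (0+1) :: Z) - D ([2, 1, 1] ++ 0 :: Z) := by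
  intro Z hZ
  simp only [GF, List.mem_cons, List.mem_nil_iff, or_false] at hZ
  subst hZ
  simp only [D, D6, alphaF, evalW, step, omega, List.cons_append, List.nil_append, List.sum_cons, List.sum_nil]; norm_num

/-- finite increments, `Y = [2, 2]`, `c = 0`: all zero-free `Z` with `Σ Z ≤ 0` (1 exact evaluation). [this work] -/
theorem incr_fin_13_0 : ∀ Z ∈ GF 0, 0 ≤ D ([2, 2] ++ (0+1) :: Z) - D ([2, 2] ++ 0 :: Z) := by
  intro Z hZ
  simp only [GF, List.mem_cons, List.mem_nil_iff, or_false] at hZ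
  subst hZ
  simp only [D, D6, alphaF, evalW, step, omega, List.cons_append, List.nil_append, List.sum_cons, List.sum_nil]; norm_num

/-- finite increments, `Y = [3, 1]`, `c = 0`: all zero-free `Z` with `Σ Z ≤ 0` (1 exact evaluation). [this work] -/
theorem incr_fin_14_0 : ∀ Z ∈ GF 0, 0 ≤ D ([3, 1] ++ (0+1) :: Z) - D ([3, 1] ++ 0 :: Z) := by
  intro Z hZ
  simp only [GF, List.mem_cons, List.mem_nil_iff, or_false] at hZ
  subst hZ
  simp only [D, D6, alphaF, evalW, step, omega, List.cons_append, List.nil_append, List.sum_cons, List.sum_nil]; norm_num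

/-- finite increments, `Y = [4]`, `c = 0`: all zero-free `Z` with `Σ Z ≤ 0` (1 exact evaluation). [this work] -/
theorem incr_fin_15_0 : ∀ Z ∈ GF 0, 0 ≤ D ([4] ++ (0+1) :: Z) - D ([4] ++ 0 :: Z) := by
  intro Z hZ
  simp only [GF, List.mem_cons, List.mem_nil_iff, or_false] at hZ
  subst hZ
  simp only [D, D6, alphaF, evalW, step, omega, List.cons_append, List.nil_append, List.sum_cons, List.sum_nil]; norm_num

/-- Dispatcher: every zero-free increment with `Σ ≤ 4` is `≥ 0`. [this work] -/
theorem incr_GF (Y : List ℕ) (hY : Y ∈ GF 4) (Z : List ℕ) (hZ0 : (0 : ℕ) ∉ Z) (c : ℕ) (hc : Y.sum + c + Z.sum ≤ 4) :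
    0 ≤ D (Y ++ (c+1) :: Z) - D (Y ++ c :: Z) := by
  simp only [GF, List.mem_cons, List.mem_nil_iff, or_false] at hY
  rcases hY with rfl|rfl|rfl|rfl|rfl|rfl|rfl|rfl|rfl|rfl|rfl|rfl|rfl|rfl|rfl|rfl
  · simp only [List.sum_nil] at hc
    have hcK : c ≤ 4 := by omega
    interval_cases c
    · exact incr_fin_0_0 Z (mem_GF Z hZ0 4 (by norm_num) (by omega))
    · exact incr_fin_0_1 Z (mem_GF Z hZ0 3 (by norm_num) (by omega))
    · exact incr_fin_0_2 Z (mem_GF Z hZ0 2 (by norm_num) (by omega))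
    · exact incr_fin_0_3 Z (mem_GF Z hZ0 1 (by norm_num) (by omega))
    · exact incr_fin_0_4 Z (mem_GF Z hZ0 0 (by norm_num) (by omega))
  · simp only [List.sum_cons, List.sum_nil] at hc
    have hcK : c ≤ 3 := by omega
    interval_cases c
    · exact incr_fin_1_0 Z (mem_GF Z hZ0 3 (by norm_num) (by omega))
    · exact incr_fin_1_1 Z (mem_GF Z hZ0 2 (by norm_num) (by omega))
    · exact incr_fin_1_2 Z (mem_GF Z hZ0 1 (by norm_num) (by omega))
    · exact incr_fin_1_3 Z (mem_GF Z hZ0 0 (by norm_num) (by omega))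
  · simp only [List.sum_cons, List.sum_nil] at hc
    have hcK : c ≤ 2 := by omega
    interval_cases c
    · exact incr_fin_2_0 Z (mem_GF Z hZ0 2 (by norm_num) (by omega))
    · exact incr_fin_2_1 Z (mem_GF Z hZ0 1 (by norm_num) (by omega))
    · exact incr_fin_2_2 Z (mem_GF Z hZ0 0 (by norm_num) (by omega))
  · simp only [List.sum_cons, List.sum_nil] at hc
    have hcK : c ≤ 2 := by omega
    interval_cases c
    · exact incr_fin_3_0 Z (mem_GF Z hZ0 2 (by norm_num) (by omega))
    · exact incr_fin_3_1 Z (mem_GF Z hZ0 1 (by norm_num) (by omega))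
    · exact incr_fin_3_2 Z (mem_GF Z hZ0 0 (by norm_num) (by omega))
  · simp only [List.sum_cons, List.sum_nil] at hc
    have hcK : c ≤ 1 := by omega
    interval_cases c
    · exact incr_fin_4_0 Z (mem_GF Z hZ0 1 (by norm_num) (by omega))
    · exact incr_fin_4_1 Z (mem_GF Z hZ0 0 (by norm_num) (by omega))
  · simp only [List.sum_cons, List.sum_nil] at hc
    have hcK : c ≤ 1 := by omega
    interval_cases c
    · exact incr_fin_5_0 Z (mem_GF Z hZ0 1 (by norm_num) (by omega))
    · exact incr_fin_5_1 Z (mem_GF Z hZ0 0 (by norm_num) (by omega))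
  · simp only [List.sum_cons, List.sum_nil] at hc
    have hcK : c ≤ 1 := by omega
    interval_cases c
    · exact incr_fin_6_0 Z (mem_GF Z hZ0 1 (by norm_num) (by omega))
    · exact incr_fin_6_1 Z (mem_GF Z hZ0 0 (by norm_num) (by omega))
  · simp only [List.sum_cons, List.sum_nil] at hc
    have hcK : c ≤ 1 := by omega
    interval_cases c
    · exact incr_fin_7_0 Z (mem_GF Z hZ0 1 (by norm_num) (by omega))
    · exact incr_fin_7_1 Z (mem_GF Z hZ0 0 (by norm_num) (by omega))
  · simp only [List.sum_cons, List.sum_nil] at hc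
    have hcK : c ≤ 0 := by omega
    interval_cases c
    · exact incr_fin_8_0 Z (mem_GF Z hZ0 0 (by norm_num) (by omega))
  · simp only [List.sum_cons, List.sum_nil] at hc
    have hcK : c ≤ 0 := by omega
    interval_cases c
    · exact incr_fin_9_0 Z (mem_GF Z hZ0 0 (by norm_num) (by omega))
  · simp only [List.sum_cons, List.sum_nil] at hc
    have hcK : c ≤ 0 := by omega
    interval_cases c
    · exact incr_fin_10_0 Z (mem_GF Z hZ0 0 (by norm_num) (by omega))
  · simp only [List.sum_cons, List.sum_nil] at hc
    have hcK : c ≤ 0 := by omega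
    interval_cases c
    · exact incr_fin_11_0 Z (mem_GF Z hZ0 0 (by norm_num) (by omega))
  · simp only [List.sum_cons, List.sum_nil] at hc
    have hcK : c ≤ 0 := by omega
    interval_cases c
    · exact incr_fin_12_0 Z (mem_GF Z hZ0 0 (by norm_num) (by omega))
  · simp only [List.sum_cons, List.sum_nil] at hc
    have hcK : c ≤ 0 := by omega
    interval_cases c
    · exact incr_fin_13_0 Z (mem_GF Z hZ0 0 (by norm_num) (by omega))
  · simp only [List.sum_cons, List.sum_nil] at hc
    have hcK : c ≤ 0 := by omega
    interval_cases c
    · exact incr_fin_14_0 Z (mem_GF Z hZ0 0 (by norm_num) (by omega))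
  · simp only [List.sum_cons, List.sum_nil] at hc
    have hcK : c ≤ 0 := by omega
    interval_cases c
    · exact incr_fin_15_0 Z (mem_GF Z hZ0 0 (by norm_num) (by omega))

/-- THEOREM M for `Σ ≤ 4`: strip the bare vertices (part V: `incr_zeroY`, `incr_zeroZ`) down to the finite table. [this work] -/
theorem D_mono_small : ∀ m : ℕ, ∀ Y Z : List ℕ, ∀ c : ℕ, Y.length + Z.length ≤ m → Y.sum + c + Z.sum ≤ 4 →
    D (Y ++ c :: Z) ≤ D (Y ++ (c+1) :: Z) := by
  intro m
  induction m with
  | zero =>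
    intro Y Z c hl hc
    have hY : Y = [] := List.eq_nil_of_length_eq_zero (by omega)
    have hZ : Z = [] := List.eq_nil_of_length_eq_zero (by omega)
    subst hY; subst hZ
    have h := incr_GF [] (by decide) [] (by simp) c hc
    linarith
  | succ m ih =>
    intro Y Z c hl hc
    by_cases hY : (0 : ℕ) ∈ Y
    · obtain ⟨Y1, Y2, rfl⟩ := split_zero Y hY
      have hl' : (Y1 ++ Y2).length + Z.length ≤ m := by
        simp only [List.length_append, List.length_cons] at hl ⊢; omega
      have hc' : (Y1 ++ Y2).sum + c + Z.sum ≤ 4 := by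
        simp only [List.sum_append, List.sum_cons] at hc ⊢; omega
      have h1 := ih (Y1 ++ Y2) Z c hl' hc'
      have h2 := incr_zeroY Y1 Y2 c Z
      linarith
    · by_cases hZ : (0 : ℕ) ∈ Z
      · obtain ⟨Z1, Z2, rfl⟩ := split_zero Z hZ
        have hl' : Y.length + (Z1 ++ Z2).length ≤ m := by
          simp only [List.length_append, List.length_cons] at hl ⊢; omega
        have hc' : Y.sum + c + (Z1 ++ Z2).sum ≤ 4 := by
          simp only [List.sum_append, List.sum_cons] at hc ⊢; omega
        have h1 := ih Y (Z1 ++ Z2) c hl' hc'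
        have h2 := incr_zeroZ Y c Z1 Z2
        linarith
      · have h := incr_GF Y (mem_GF Y hY 4 (by norm_num) (by omega)) Z hZ c hc
        linarith

/-- **THEOREM M (CONJ M of gen 63).**  For every hub word, raising any letter by one (adding a pendant hub at that cycle vertex, a bare vertex
included) never lowers `D = #P1 − #bad`: `D (Y ++ c :: Z) ≤ D (Y ++ (c+1) :: Z)`. [this work] -/
theorem D_mono (Y : List ℕ) (c : ℕ) (Z : List ℕ) : D (Y ++ c :: Z) ≤ D (Y ++ (c+1) :: Z) := by
  rcases Nat.lt_or_ge (Y ++ c :: Z).sum 5 with h | h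
  · refine D_mono_small (Y.length + Z.length) Y Z c le_rfl ?_
    simp only [List.sum_append, List.sum_cons] at h; omega
  · exact D_mono_of_five_le Y c Z h

/-- Raising a letter by any amount. [this work] -/
theorem D_mono_add (Y : List ℕ) (c k : ℕ) (Z : List ℕ) : D (Y ++ c :: Z) ≤ D (Y ++ (c+k) :: Z) := by
  induction k with
  | zero => simp only [add_zero]; exact le_rfl
  | succ k ih => exact le_trans ih (by rw [← add_assoc]; exact D_mono Y (c+k) Z)

/-- Letterwise monotonicity behind a common prefix. [this work] -/
theorem D_mono_forall₂ (w w' : List ℕ) (h : List.Forall₂ (· ≤ ·) w w') : ∀ P : List ℕ, D (P ++ w) ≤ D (P ++ w') := by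
  induction h with
  | nil => intro P; exact le_rfl
  | @cons a b u u' hab _ ih =>
    intro P
    obtain ⟨k, rfl⟩ := Nat.exists_eq_add_of_le hab
    have h1 := D_mono_add P a k u
    have h2 := ih (P ++ [a+k])
    simp only [List.append_assoc, List.singleton_append] at h2
    exact le_trans h1 h2

/-- **THEOREM M, final form.**  `D` is nondecreasing in the letterwise order on hub words of equal length: if `w_t ≤ w′_t` for all `t` then `D w ≤ D w′`.
Together with THEOREM B (`hubWords_D_nonneg`) and `D [] = D [1] = D [2] = D [1,1] = 0` this pins down the minimal hub words. [this work] -/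
theorem hubWords_D_monotone (w w' : List ℕ) (h : List.Forall₂ (· ≤ ·) w w') : D w ≤ D w' := by
  simpa using D_mono_forall₂ w w' h []

end Summit.CriticalPhenomena.PercolationContinuityZ3.Theorems.ProductFormHubWords
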